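import Mathlib.RingTheory.Spectrum.Prime.FreeLocus
import Mathlib.RingTheory.KrullDimension.Zero
import Mathlib.RingTheory.LocalProperties.Reduced
import Mathlib.RingTheory.Localization.Free
import HarnessLib

/-!
# Generic freeness over a reduced ring (the open `U_k` of BLR 3.3/4, second condition)

Topic: `Literature/AlgebraicGeometry/Smoothening` (Bosch–Lütkebohmert–Raynaud, *Néron Models*,
§3.3, Lemma 4: on a dense open `U_k` of the reduced centre `Y_k` the restriction
`Ω¹_{X/R}|_{U_k}` is locally free). The commutative algebra: over a **reduced** ring `R` every
module is free at the generic points (the local ring at a minimal prime is a reduced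
zero-dimensional local ring, i.e. a field: `free_localizedModule_of_mem_minimalPrimes`), so the
free locus of any module is dense (`dense_freeLocus`), and a finitely presented module is free
on a principal open neighbourhood `D(r)` of each generic point (`exists_free_away_of_mem_minimalPrimes`,
Mathlib's generic freeness `Module.FinitePresentation.exists_free_localizedModule_powers`).
Mathlib-only. [folklore]; no named facts (D-0026).

## References

* S. Bosch, W. Lütkebohmert, M. Raynaud, *Néron Models*, Springer 1990, §3.3, Lemma 4.
  [BLRNeronModels1990] (Not held; number only.)
* A. Grothendieck, *EGA* IV_2, 6.9.1–6.9.2 (generic freeness/flatness). [EGAIV2]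
-/

namespace Literature.AlgebraicGeometry.Smoothening

universe u v

variable {R : Type u} [CommRing R] (M : Type v) [AddCommGroup M] [Module R M]

/-- **At a generic point of a reduced ring every module is free**: for a minimal prime `p` of a
reduced ring `R`, the localisation `R_p` is a field, so `M_p` is free. [folklore] -/
theorem free_localizedModule_of_mem_minimalPrimes [IsReduced R] {p : Ideal R}
    (hp : p ∈ minimalPrimes R) :
    haveI := hp.1.1
    Module.Free (Localization.AtPrime p) (LocalizedModule p.primeCompl M) := by
  haveI := hp.1.1
  haveI : Ring.KrullDimLE 0 (Localization.AtPrime p) := Ring.KrullDimLE.of_isLocalization p hp _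
  have hF : IsField (Localization.AtPrime p) := Ring.KrullDimLE.isField_of_isReduced
  letI := hF.toField
  exact Module.Free.of_divisionRing _ _

/-- The generic points of a reduced ring lie in the free locus of every module. [folklore] -/
theorem mem_freeLocus_of_mem_minimalPrimes [IsReduced R] {p : Ideal R}
    (hp : p ∈ minimalPrimes R) : ⟨p, hp.1.1⟩ ∈ Module.freeLocus R M :=
  free_localizedModule_of_mem_minimalPrimes M hp

/-- **The free locus of a module over a reduced ring is dense.** [folklore] -/
theorem dense_freeLocus [IsReduced R] : Dense (Module.freeLocus R M) := by
  intro q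
  obtain ⟨p, hp, hpq⟩ :=
    Ideal.exists_minimalPrimes_le (show (⊥ : Ideal R) ≤ q.asIdeal from bot_le)
  have hmem := mem_freeLocus_of_mem_minimalPrimes M hp
  have hspec : (⟨p, hp.1.1⟩ : PrimeSpectrum R) ⤳ q :=
    (PrimeSpectrum.le_iff_specializes _ _).mp hpq
  exact closure_mono (Set.singleton_subset_iff.mpr hmem) (specializes_iff_mem_closure.mp hspec)

/-- **Generic freeness on a reduced ring** (BLR 3.3/4, the open `U_k`; EGA IV 6.9.2): a
finitely presented module over a reduced ring is free on a principal open neighbourhood `D(r)`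
of each generic point `p` (`r ∉ p`). [cite: EGAIV2, 6.9.2] -/
theorem exists_free_away_of_mem_minimalPrimes [IsReduced R] [Module.FinitePresentation R M]
    {p : Ideal R} (hp : p ∈ minimalPrimes R) :
    ∃ r ∉ p, Module.Free (Localization (.powers r)) (LocalizedModule.Away r M) := by
  haveI := hp.1.1
  haveI := free_localizedModule_of_mem_minimalPrimes M hp
  obtain ⟨r, hr, hfree, -⟩ := Module.FinitePresentation.exists_free_localizedModule_powers
    p.primeCompl (LocalizedModule.mkLinearMap p.primeCompl M) (Localization.AtPrime p)
  exact ⟨r, hr, hfree⟩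

end Literature.AlgebraicGeometry.Smoothening
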